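import Summits.CriticalPhenomena.PercolationContinuityZ3.Theorems.PercNearOneGluingNoHeavyLowerTailSahiHittingFiveBoxData
import Summits.CriticalPhenomena.PercolationContinuityZ3.Theorems.PercNearOneGluingNoHeavyLowerTailSahiHittingFiveBoxCertI
import HarnessLib

/-!
# `NoHeavyLowerTail` (stmt-CriticalPhenomena-4575) — kernel certificates `J` for the universal order-5 hitting polynomial on `[0,1]³¹`

Support file, seat `prim-l12-p5` (gen 10), `--supports stmt-CriticalPhenomena-4575`.  COMPUTATIONAL: `native_decide` runs of `SahiHitting.boxcheckK`
(pruned recursive Bernstein slicing with the monomial-domination leaf test, `…SahiHittingBoxRecursive`) on the singleton-vertex pre-slices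
`p5SliceS s` of `p5K` (`…SahiHittingFiveBoxData`), for the vertices `s` listed below (node counts from the seat engine `code/psplit.py`); assembled in
`…SahiHittingFiveBox`.  No sorries. [this work]
-/

namespace Summit.CriticalPhenomena.PercolationContinuityZ3.Theorems

namespace SahiHitting

/-- Certificate for the vertex `s = (1,1,1,1,1)`, sub-slice `a = 2` of the pair variable `r_{01}`. [this work] -/
theorem p5_cert_11111_2 : boxcheckK (p5VarsRest.drop 1) (slice1K 5 2 2 (p5SliceS 1 1 1 1 1)) = true := by
  native_decide

/-- The sliced variable indices below the pair variable `5` are `< 31`. [this work] -/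
theorem p5VarsRest_drop_lt : ∀ vd ∈ p5VarsRest.drop 1, vd.1 < 31 := fun vd hvd => p5VarsRest_lt vd (List.drop_subset 1 _ hvd)

/-- **The vertex `(1,1,1,1,1)` pre-slice is `≥ 0` on the box** (from its three sub-certificates). [this work] -/
theorem p5Slice11111_nonneg (x : Fin 31 → ℝ) (hx : ∀ j, 0 ≤ x j ∧ x j ≤ 1) : 0 ≤ evalKL 31 (p5SliceS 1 1 1 1 1) x := by
  have hdeg := p5SliceS_deg 1 1 1 1 1
  have hdeg' : ∀ t ∈ p5SliceS 1 1 1 1 1, ∀ vd ∈ p5VarsRest.drop 1, t.2.getD vd.1 0 ≤ vd.2 :=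
    fun t ht vd hvd => hdeg t ht vd (List.drop_subset 1 _ hvd)
  refine evalKL_nonneg_of_slices (i := 5) (d := 2) (by norm_num) _ (fun t ht => hdeg t ht (5, 2) (by decide)) (fun a ha y hy => ?_) x hx
  interval_cases a
  · exact evalKL_nonneg_of_boxcheckK _ _ p5_cert_11111_0 p5VarsRest_drop_lt (deg_slice1K hdeg') y hy
  · exact evalKL_nonneg_of_boxcheckK _ _ p5_cert_11111_1 p5VarsRest_drop_lt (deg_slice1K hdeg') y hy
  · exact evalKL_nonneg_of_boxcheckK _ _ p5_cert_11111_2 p5VarsRest_drop_lt (deg_slice1K hdeg') y hy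

end SahiHitting

end Summit.CriticalPhenomena.PercolationContinuityZ3.Theorems
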